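import Literature.NumberTheory.EllipticCurves.Disegni2017.ChiLineTheoremBPinAtProofs
import HarnessLib

/-!
# Disegni 2017, Theorem B at `χ = ψ ∘ N_{K/ℚ}` — the PINNED datum with the EXISTENCE of the canonical
# cyclotomic datum taken ON THE FRAME (proof file)

Topic `Literature/NumberTheory/EllipticCurves`, cluster `Disegni2017` (namespace = path). Companion of
`ChiLineTheoremB.lean` (ty2 g50: the named fact `thmB_chi_quadraticBaseChange`) and
`ChiLineTheoremBPinAtProofs.lean` (-w8 g27: `exists_datum_pinned_of_pinAt`,
`exists_datum_pinned_of_fixing_of_pinAt` — Theorem B COMPOSED with the global named fact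
`WeierstrassCurve.exists_isCanonicalCyc` and a pointwise pin). Written by the LEAD seat `bsd-line-cf2-p1`
(g23) of the cell `bsd-print-cf2` (crux stmt-BirchSwinnertonDyer-20368, line `disegni_pair_two`,
skeleton v3.8 «EXISTENCE ON THE FRAME»). THEOREMS ONLY: no `def`, no new named fact, no `sorry`.

## What, and why

The global named fact `exists_isCanonicalCyc` (existence of THE canonical cyclotomic `p`-adic height datum
over every number field `H`, for every globally minimal `W` with good ordinary reduction at `p`) is, on the
frame of the cell's crux (`p = 2`, `W ⊗ ℚ₂` with a Mazur–Tate sigma-squared pair), the target of a proof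
programme in the tree (width seat `bsd-line-cf2-p1-w8` g28: `CanonicalPAdicHeightCycLocusTwoProofs`,
`CanonicalPAdicHeightCycGaloisProofs`, `PadicSeriesEvaluationNormedAlgebra`, …, towards
`exists_isCanonicalCyc_two_of_pair`). To let that theorem replace the print WITHOUT proving the
all-`(W, p, H)` fact, this file restates the two repackagings of `ChiLineTheoremBPinAtProofs.lean` with
the hypothesis `(hE : exists_isCanonicalCyc)` REPLACED by the existence FOR THE FIXED FRAME `(W, p, H)`,

  `∃ DH₀ : PAdicHeightDataK W p H, DH₀.IsCanonicalCyc ∧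
     ∀ σ a b, ⟨σa, σb⟩_{DH₀} = ⟨a, b⟩_{DH₀}`,

an ordinary hypothesis INSIDE the universally quantified frame (next to the pointwise pin), so that the
universal constant `c ∈ ℚ^×` of Theorem B is still quantified BEFORE the frame, and the instance binder
`[(W.baseChange H).IsGloballyMinimal]` (the named fact's wording) is no longer needed. Same proofs as
-w8 g27's (the only use of `hE` there is `hE W p H hord.1 hord.2`); the old theorems are the special case
`hEAt := hE W p H hord.1 hord.2` (`exists_datum_pinned_of_pinAt_of_existsAt_of_exists` records this).

* `thmB_chi_quadraticBaseChange.exists_datum_pinned_of_pinAt_of_existsAt` — binder «`G = {1, τ}`»;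
* `thmB_chi_quadraticBaseChange.exists_datum_pinned_of_fixing_of_pinAt_of_existsAt` — binder «`G` fixes
  `K`» (the route item's), reduced to the first by
  `Literature.FieldTheory.Galois.QuadraticExtension.subgroup_eq_one_or_eq_of_fixing`;
* `thmB_chi_quadraticBaseChange.existsAt_of_exists` — the global fact implies the frame hypothesis.

BSD is not proved by any of this; Theorem B is not proved here (it stays the hypothesis `hB`).

## References

* [Disegni2017] D. Disegni, *The p-adic Gross–Zagier formula on Shimura curves*, Compos. Math. 153 (2017)
  = arXiv:1510.02114v3: Thm. B = «Theorem 2» (PDF p. 8 L9–18), §1.3.1 (p. 7 L30–50), (4.1.7) (p. 28 L97–101).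
* [MazurSteinTate2006] B. Mazur, W. Stein, J. Tate, *Computation of p-adic heights and log convergence*,
  Doc. Math. Extra Vol. Coates (2006), §2.7–2.8 (PDF p. 11).
* [DummitFoote2004] §14.1 Example (1) after Prop. 2 (automorphisms of a quadratic extension).
-/

noncomputable section

open scoped MatrixGroups ModularForm NumberField Classical
open CongruenceSubgroup NumberField IsDedekindDomain WeierstrassCurve
open Literature.NumberTheory.EllipticCurves.ModularForms
open Literature.NumberTheory.Automorphic

namespace Literature.NumberTheory.EllipticCurves.Disegni2017

namespace thmB_chi_quadraticBaseChange

/-! ### §1 Binder «`G = {1, τ}`», existence and pin on the frame -/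

/-- **The pinned Disegni datum, EXISTENCE AND PIN ON THE FRAME** — `thmB_chi_quadraticBaseChange` with,
for the fixed frame `(W, p, d, H)`, the hypotheses (i) «a canonical cyclotomic `H`-datum `DH₀` of `W`
exists and is `Aut(H/ℚ)`-invariant» and (ii) «every canonical cyclotomic `H`-datum agrees with every
canonical Sq-minus-twist `ℚ`-datum `Dc` of `W^{(d)}` on `H`-points above `X/d`»: there is a universal
`c ∈ ℚ^×` such that on every such frame there is a datum `DH` on `E(H)` (namely `c • DH₀`) which is
`Aut(H/ℚ)`-invariant, satisfies `ChiLineGrossZagierClauses ι K W H f a (ψ∘N) 𝔭 𝔭′ G χ DH`, and whose value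
on every `H`-point `P′` of `W` with `x(P′) = X/d` is `c ·` the value of any canonical minus-twist datum
`Dc` on `P = (X, Y)`. PROVED from the fact (same proof as `exists_datum_pinned_of_pinAt`, whose global
existence hypothesis is used only on the frame). [cite: Disegni2017, Theorem B (arXiv v3 PDF p. 8 L9–18), (4.1.7) (p. 28 L97–101)]
[cite: MazurSteinTate2006, §2.7–2.8 (PDF p. 11)] -/
theorem exists_datum_pinned_of_pinAt_of_existsAt (hB : thmB_chi_quadraticBaseChange)
    {p : ℕ} [Fact p.Prime] :
    ∃ c : ℚ, c ≠ 0 ∧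
      ∀ (ι : PadicAlgCl p ≃+* ℂ) (K : Type) [Field K] [NumberField K] [IsGalois ℚ K]
        (𝔭 𝔭' : HeightOneSpectrum (𝓞 K)) (W : WeierstrassCurve ℚ) [W.IsElliptic] [W.IsGloballyMinimal]
        {N : ℕ} [NeZero N] (f : CuspForm (Gamma0 N) 2) {m : ℕ} [NeZero m] (ψ : DirichletCharacter ℂ m)
        (d : ℤ) [(W.quadraticTwist (d : ℚ)).IsElliptic] (H : Type) [Field H] [NumberField H] [Algebra K H]
        (t : H) (τ : H ≃ₐ[ℚ] H) (G : Subgroup (H ≃ₐ[ℚ] H)) (χ : G →* ℂˣ) (hτG : τ ∈ G),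
        (∃ DH₀ : PAdicHeightDataK W p H, DH₀.IsCanonicalCyc ∧
            ∀ (σ : H ≃ₐ[ℚ] H) (a b : (W.baseChange H).toAffine.Point),
              DH₀.pairing (pointGalHom W H σ a) (pointGalHom W H σ b) = DH₀.pairing a b) →
        (∀ (DH₀ : PAdicHeightDataK W p H) (Dc : PAdicHeightData (W.quadraticTwist (d : ℚ)) p),
            DH₀.IsCanonicalCyc → Dc.IsCanonicalSqMinusTwist →
              ∀ {X Y : ℚ} (hP : (W.quadraticTwist (d : ℚ)).toAffine.Nonsingular X Y) {x' y' : H}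
                (hP' : (W.baseChange H).toAffine.Nonsingular x' y'),
                x' = algebraMap ℚ H (X / (d : ℚ)) →
                  DH₀.pairing (.some x' y' hP') (.some x' y' hP') =
                    Dc.pairing (.some X Y hP) (.some X Y hP)) →
        IsImaginaryQuadratic K → ((Ideal.span {(p : ℤ)}).primesOver (𝓞 K)).ncard = 2 →
        ((p : ℕ) : 𝓞 K) ∈ 𝔭.asIdeal → ((p : ℕ) : 𝓞 K) ∈ 𝔭'.asIdeal → 𝔭 ≠ 𝔭' →
        IsNewformOf W f → IsOrdinaryAt W p →
        (∀ ℓ : ℕ, ℓ.Prime → ℓ ≠ 2 → ¬ ℓ ∣ m → ψ ℓ = (jacobiSym d ℓ : ℂ)) →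
        (∀ ℓ : ℕ, ℓ.Prime → ℓ ∣ m → ¬ ℓ ^ 2 ∣ N) →
        IsNotExceptionalAt (p := p) (ι (((unitRoot W p : ℚ_[p]) : PadicAlgCl p))) (baseChangeDirichlet K ψ) 𝔭 →
        IsNotExceptionalAt (p := p) (ι (((unitRoot W p : ℚ_[p]) : PadicAlgCl p))) (baseChangeDirichlet K ψ) 𝔭' →
        (∀ Λ : ℂ → ℂ, Differentiable ℂ Λ →
          (∀ s : ℂ, 2 < s.re → Λ s = rankinSelbergEulerProductHecke f (baseChangeDirichlet K ψ) s) →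
            Λ 1 = 0 ∧ deriv Λ 1 ≠ 0) →
        Module.finrank K H = 2 → t ^ 2 = algebraMap ℚ H (d : ℚ) → t ∉ Set.range (algebraMap K H) →
        (∀ a : K, τ (algebraMap K H a) = algebraMap K H a) → τ t = -t →
        (∀ σ : G, (σ : H ≃ₐ[ℚ] H) = 1 ∨ (σ : H ≃ₐ[ℚ] H) = τ) → ((χ ⟨τ, hτG⟩ : ℂˣ) : ℂ) = -1 →
        ∃ DH : PAdicHeightDataK W p H,
          (∀ (σ : H ≃ₐ[ℚ] H) (a b : (W.baseChange H).toAffine.Point),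
              DH.pairing (pointGalHom W H σ a) (pointGalHom W H σ b) = DH.pairing a b) ∧
          ChiLineGrossZagierClauses ι K W H f (ι (((unitRoot W p : ℚ_[p]) : PadicAlgCl p)))
            (baseChangeDirichlet K ψ) 𝔭 𝔭' G χ DH ∧
          ∀ (Dc : PAdicHeightData (W.quadraticTwist (d : ℚ)) p), Dc.IsCanonicalSqMinusTwist →
            ∀ {X Y : ℚ} (hP : (W.quadraticTwist (d : ℚ)).toAffine.Nonsingular X Y) {x' y' : H}
              (hP' : (W.baseChange H).toAffine.Nonsingular x' y'),
              x' = algebraMap ℚ H (X / (d : ℚ)) →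
                DH.pairing (.some x' y' hP') (.some x' y' hP') =
                  (c : ℚ_[p]) * Dc.pairing (.some X Y hP) (.some X Y hP) := by
  obtain ⟨c, hc, h⟩ := hB (p := p)
  refine ⟨c, hc, ?_⟩
  intro ι K _ _ _ 𝔭 𝔭' W _ _ N _ f m _ ψ d _ H _ _ _ t τ G χ hτG hEAt hPinAt hK hsplit h𝔭 h𝔭' hne hf hord
    hψ hmN hexc hexc' hΛ hKH ht2 htK hτK hτt hG hχ
  obtain ⟨DH₀, hcan, hinv⟩ := hEAt
  refine ⟨DH₀.smul c, fun σ a b => PAdicHeightDataK.smul_pairing_invariant c (hinv σ) a b,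
    h ι K 𝔭 𝔭' W f ψ d H t τ G χ hτG hK hsplit h𝔭 h𝔭' hne hf hord hψ hmN hexc hexc' hΛ hKH ht2 htK
      hτK hτt hG hχ DH₀ hcan, ?_⟩
  intro Dc hDc X Y hP x' y' hP' hx'
  rw [PAdicHeightDataK.smul_pairing, hPinAt DH₀ Dc hcan hDc hP hP' hx']

/-! ### §2 Binder «`G` fixes `K`», existence and pin on the frame -/

/-- **The pinned Disegni datum, `K`-FIXING form of the Galois binder, EXISTENCE AND PIN ON THE FRAME**:
as `exists_datum_pinned_of_pinAt_of_existsAt`, but the hypothesis on `G ≤ Aut(H/ℚ)` is «every `σ ∈ G`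
fixes `K` pointwise» (with `τ ∈ G`), which for the quadratic `H = K(t)` is EQUIVALENT to «every `σ ∈ G` is
`1` or `τ`» (`Literature.FieldTheory.Galois.QuadraticExtension.subgroup_eq_one_or_eq_of_fixing`). This is
the binder of the route item `PrintCf2.SplitBadTwoDisegniGZPairOfFacts` and of the crux line's ticket.
PROVED from the named fact. [cite: Disegni2017, Theorem B (arXiv v3 PDF p. 8 L9–18)]
[cite: DummitFoote2004, §14.1 Example (1) after Prop. 2] -/
theorem exists_datum_pinned_of_fixing_of_pinAt_of_existsAt (hB : thmB_chi_quadraticBaseChange)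
    {p : ℕ} [Fact p.Prime] :
    ∃ c : ℚ, c ≠ 0 ∧
      ∀ (ι : PadicAlgCl p ≃+* ℂ) (K : Type) [Field K] [NumberField K] [IsGalois ℚ K]
        (𝔭 𝔭' : HeightOneSpectrum (𝓞 K)) (W : WeierstrassCurve ℚ) [W.IsElliptic] [W.IsGloballyMinimal]
        {N : ℕ} [NeZero N] (f : CuspForm (Gamma0 N) 2) {m : ℕ} [NeZero m] (ψ : DirichletCharacter ℂ m)
        (d : ℤ) [(W.quadraticTwist (d : ℚ)).IsElliptic] (H : Type) [Field H] [NumberField H] [Algebra K H]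
        (t : H) (τ : H ≃ₐ[ℚ] H) (G : Subgroup (H ≃ₐ[ℚ] H)) (χ : G →* ℂˣ) (hτG : τ ∈ G),
        (∃ DH₀ : PAdicHeightDataK W p H, DH₀.IsCanonicalCyc ∧
            ∀ (σ : H ≃ₐ[ℚ] H) (a b : (W.baseChange H).toAffine.Point),
              DH₀.pairing (pointGalHom W H σ a) (pointGalHom W H σ b) = DH₀.pairing a b) →
        (∀ (DH₀ : PAdicHeightDataK W p H) (Dc : PAdicHeightData (W.quadraticTwist (d : ℚ)) p),
            DH₀.IsCanonicalCyc → Dc.IsCanonicalSqMinusTwist →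
              ∀ {X Y : ℚ} (hP : (W.quadraticTwist (d : ℚ)).toAffine.Nonsingular X Y) {x' y' : H}
                (hP' : (W.baseChange H).toAffine.Nonsingular x' y'),
                x' = algebraMap ℚ H (X / (d : ℚ)) →
                  DH₀.pairing (.some x' y' hP') (.some x' y' hP') =
                    Dc.pairing (.some X Y hP) (.some X Y hP)) →
        IsImaginaryQuadratic K → ((Ideal.span {(p : ℤ)}).primesOver (𝓞 K)).ncard = 2 →
        ((p : ℕ) : 𝓞 K) ∈ 𝔭.asIdeal → ((p : ℕ) : 𝓞 K) ∈ 𝔭'.asIdeal → 𝔭 ≠ 𝔭' →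
        IsNewformOf W f → IsOrdinaryAt W p →
        (∀ ℓ : ℕ, ℓ.Prime → ℓ ≠ 2 → ¬ ℓ ∣ m → ψ ℓ = (jacobiSym d ℓ : ℂ)) →
        (∀ ℓ : ℕ, ℓ.Prime → ℓ ∣ m → ¬ ℓ ^ 2 ∣ N) →
        IsNotExceptionalAt (p := p) (ι (((unitRoot W p : ℚ_[p]) : PadicAlgCl p))) (baseChangeDirichlet K ψ) 𝔭 →
        IsNotExceptionalAt (p := p) (ι (((unitRoot W p : ℚ_[p]) : PadicAlgCl p))) (baseChangeDirichlet K ψ) 𝔭' →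
        (∀ Λ : ℂ → ℂ, Differentiable ℂ Λ →
          (∀ s : ℂ, 2 < s.re → Λ s = rankinSelbergEulerProductHecke f (baseChangeDirichlet K ψ) s) →
            Λ 1 = 0 ∧ deriv Λ 1 ≠ 0) →
        Module.finrank K H = 2 → t ^ 2 = algebraMap ℚ H (d : ℚ) → t ∉ Set.range (algebraMap K H) →
        (∀ a : K, τ (algebraMap K H a) = algebraMap K H a) → τ t = -t →
        (∀ (σ : G) (a : K), (σ : H ≃ₐ[ℚ] H) (algebraMap K H a) = algebraMap K H a) →
        ((χ ⟨τ, hτG⟩ : ℂˣ) : ℂ) = -1 →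
        ∃ DH : PAdicHeightDataK W p H,
          (∀ (σ : H ≃ₐ[ℚ] H) (a b : (W.baseChange H).toAffine.Point),
              DH.pairing (pointGalHom W H σ a) (pointGalHom W H σ b) = DH.pairing a b) ∧
          ChiLineGrossZagierClauses ι K W H f (ι (((unitRoot W p : ℚ_[p]) : PadicAlgCl p)))
            (baseChangeDirichlet K ψ) 𝔭 𝔭' G χ DH ∧
          ∀ (Dc : PAdicHeightData (W.quadraticTwist (d : ℚ)) p), Dc.IsCanonicalSqMinusTwist →
            ∀ {X Y : ℚ} (hP : (W.quadraticTwist (d : ℚ)).toAffine.Nonsingular X Y) {x' y' : H}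
              (hP' : (W.baseChange H).toAffine.Nonsingular x' y'),
              x' = algebraMap ℚ H (X / (d : ℚ)) →
                DH.pairing (.some x' y' hP') (.some x' y' hP') =
                  (c : ℚ_[p]) * Dc.pairing (.some X Y hP) (.some X Y hP) := by
  obtain ⟨c, hc, h⟩ := exists_datum_pinned_of_pinAt_of_existsAt hB (p := p)
  refine ⟨c, hc, ?_⟩
  intro ι K _ _ _ 𝔭 𝔭' W _ _ N _ f m _ ψ d _ H _ _ _ t τ G χ hτG hEAt hPinAt hK hsplit h𝔭 h𝔭' hne hf hord
    hψ hmN hexc hexc' hΛ hKH ht2 htK hτK hτt hGK hχ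
  -- `t² ∈ K`: `algebraMap ℚ H d = algebraMap K H d` for the integer `d`
  have hte : t ^ 2 = algebraMap K H (d : K) := by rw [ht2, map_intCast, map_intCast]
  have hG : ∀ σ : G, (σ : H ≃ₐ[ℚ] H) = 1 ∨ (σ : H ≃ₐ[ℚ] H) = τ :=
    Literature.FieldTheory.Galois.QuadraticExtension.subgroup_eq_one_or_eq_of_fixing hKH htK hte hτK
      hτt hGK
  exact h ι K 𝔭 𝔭' W f ψ d H t τ G χ hτG hEAt hPinAt hK hsplit h𝔭 h𝔭' hne hf hord hψ hmN hexc hexc' hΛ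
    hKH ht2 htK hτK hτt hG hχ

/-! ### §3 The global named fact implies the frame hypothesis -/

/-- **The global existence fact implies existence on every frame** with `W ⊗ H` globally minimal and
`W` good ordinary at `p` (so `exists_datum_pinned_of_pinAt` / `…_of_fixing_of_pinAt` are the corollaries
`hEAt := existsAt_of_exists hE W p H hord` of §1–§2). Trivial specialisation; recorded for the consumer's
bookkeeping. [cite: MazurSteinTate2006, §2.7–2.8 (PDF p. 11)] -/
theorem existsAt_of_exists (hE : exists_isCanonicalCyc) (W : WeierstrassCurve ℚ) [W.IsElliptic]
    [W.IsGloballyMinimal] (p : ℕ) [Fact p.Prime] (H : Type) [Field H] [NumberField H]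
    [(W.baseChange H).IsGloballyMinimal] (hord : IsOrdinaryAt W p) :
    ∃ DH₀ : PAdicHeightDataK W p H, DH₀.IsCanonicalCyc ∧
      ∀ (σ : H ≃ₐ[ℚ] H) (a b : (W.baseChange H).toAffine.Point),
        DH₀.pairing (pointGalHom W H σ a) (pointGalHom W H σ b) = DH₀.pairing a b :=
  hE W p H hord.1 hord.2

end thmB_chi_quadraticBaseChange

end Literature.NumberTheory.EllipticCurves.Disegni2017

end
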